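import Mathlib.Analysis.Normed.Module.Convex
import Literature.Probability.LatticeModels.MedialInterface
import Literature.Probability.Percolation.BoxCrossingProofs

/-!
# Deep lattice edges are not `A`–`B` edges (helper for stub `stub_traceIdentity`)

Line `finitary-green-pairing` of the crux `CoherentMorera` (route `CardyComplexCone`,
stmt-CriticalPhenomena-11388). Deterministic mesh-domain geometry, for ANY discrete Dobrushin datum
`E` (domain `E.Ω`, mesh `E.δ ≥ 0`; no admissibility, openness or connectedness is used):

* `not_mem_zdBoundary_of_closedBall_subset`: a site `v` whose closed mesh ball
  `closedBall (δv) (3δ/2)` lies in `E.Ω` is not on the square-lattice discrete boundary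
  `E.zdBoundary` (neither a vertex-boundary site of `Ω_δ` nor an endpoint of a face-boundary edge);
* `medialPoint_far_not_mem_zdABEdges` (registered helper): a lattice edge `s(x, x + eᵢ)` whose
  closed `2δ`-ball about its midpoint lies in `E.Ω` is not an `A`–`B` edge of `E` (an `A`–`B` edge
  has an endpoint on `zdArcA ⊆ zdBoundary`, and both endpoints are `3δ/2`-deep).

The one non-trivial input is that the discrete domain `Ω_δ = meshDomain Ω δ` ("the largest connected
component", `DomainDiscretisation.lean`) is a union of whole connected components of the mesh vertex
graph, so a mesh vertex joined in the mesh graph to a site of `Ω_δ` is itself in `Ω_δ` (the tree's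
`Literature.Probability.Percolation.mem_meshDomain_of_meshGraph_adj`). A boundary site lies in `Ω_δ`
by definition; its `ℤ²`-neighbours and the corners of the faces around it are mesh vertices joined
to it by lattice segments inside the ball, hence in `Ω_δ`, which contradicts each of the two clauses
of `zdBoundary`. This is the elementary square-lattice form of "interior vertices / interior
squares of `Ω_δ`" (S. Smirnov, Ann. of Math. 172 (2010), §3); nothing probabilistic is involved.
-/

namespace Summit.CriticalPhenomena.CardyFormulaZ2.Cruxes.CoherentMorera.FinitaryGreenPairing

open Set Metric
open Literature.Probability.LatticeModels

namespace TraceIdentity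

/-! ## Lattice bookkeeping -/

/-- `ℤ²`-neighbours are within sup-distance one. -/
theorem near_of_adj {v w : Site 2} (h : (zdGraph 2).Adj v w) : ∀ j, |w j - v j| ≤ 1 := by
  intro j
  rcases (zdGraph_adj_iff v w).1 h with ⟨i, rfl | rfl⟩
  · by_cases hj : j = i <;> simp [hj]
  · by_cases hj : j = i <;> simp [hj]

/-- Two corners of one face are within sup-distance one. -/
theorem near_of_isCorner {v w f : Site 2} (hv : IsCorner v f) (hw : IsCorner w f) :
    ∀ j, |w j - v j| ≤ 1 := by
  intro j
  rcases hv j with h | h <;> rcases hw j with h' | h' <;> rw [h, h', abs_le] <;>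
    constructor <;> linarith

/-- Mesh points of sites within sup-distance one are within `3δ/2` (indeed `√2·δ`; `δ ≥ 0`). -/
theorem dist_meshPoint_le_of_near {δ : ℝ} (hδ : 0 ≤ δ) {v w : Site 2} (h : ∀ j, |w j - v j| ≤ 1) :
    dist (meshPoint δ w) (meshPoint δ v) ≤ 3 / 2 * δ := by
  have k0 : |((w 0 : ℤ) : ℝ) - v 0| ≤ 1 := by exact_mod_cast h 0
  have k1 : |((w 1 : ℤ) : ℝ) - v 1| ≤ 1 := by exact_mod_cast h 1
  rw [abs_le] at k0 k1
  have ha : (((w 0 : ℤ) : ℝ) - v 0) ^ 2 ≤ 1 := by nlinarith [k0.1, k0.2]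
  have hb : (((w 1 : ℤ) : ℝ) - v 1) ^ 2 ≤ 1 := by nlinarith [k1.1, k1.2]
  have hs : δ ^ 2 * ((((w 0 : ℤ) : ℝ) - v 0) ^ 2 + (((w 1 : ℤ) : ℝ) - v 1) ^ 2) ≤ δ ^ 2 * 2 :=
    mul_le_mul_of_nonneg_left (by linarith) (sq_nonneg δ)
  rw [Complex.dist_eq]
  refine le_of_pow_le_pow_left₀ two_ne_zero (by positivity) ?_
  rw [Complex.sq_norm, Complex.normSq_apply]
  simp only [Complex.sub_re, Complex.sub_im, meshPoint_re, meshPoint_im]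
  nlinarith [hs, sq_nonneg δ]

/-- Sites differing by at most one in a single coordinate are equal or `ℤ²`-adjacent. -/
theorem eq_or_adj_of_coord {w w' : Site 2} (i : Fin 2) (hj : ∀ j, j ≠ i → w' j = w j)
    (hi : |w' i - w i| ≤ 1) : w = w' ∨ (zdGraph 2).Adj w w' := by
  have h3 : w' i = w i ∨ w' i = w i + 1 ∨ w i = w' i + 1 := by
    rcases abs_le.1 hi with ⟨h1, h2⟩
    omega
  rcases h3 with h | h | h
  · left
    funext j
    by_cases hji : j = i
    · subst hji; exact h.symm
    · exact (hj j hji).symm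
  · right
    rw [zdGraph_adj_iff]
    refine ⟨i, Or.inl (funext fun j => ?_)⟩
    by_cases hji : j = i
    · subst hji; simp [h]
    · simp [hji, hj j hji]
  · right
    rw [zdGraph_adj_iff]
    refine ⟨i, Or.inr (funext fun j => ?_)⟩
    by_cases hji : j = i
    · subst hji; simp [h]
    · simp [hji, hj j hji]

/-- The mesh vector of a unit lattice vector has length `|δ|`. -/
theorem norm_meshPoint_single (δ : ℝ) (i : Fin 2) : ‖meshPoint δ (Pi.single i 1)‖ = |δ| := by
  have h : meshPoint δ (Pi.single i 1) = if i = 0 then (δ : ℂ) else (δ : ℂ) * Complex.I := by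
    fin_cases i <;> apply Complex.ext <;> simp [meshPoint]
  rw [h]
  split_ifs <;> simp

/-- Each endpoint of the lattice edge `s(x, x + eᵢ)` is at distance `δ/2` from its midpoint
(`δ ≥ 0`). -/
theorem dist_meshPoint_medialPoint {δ : ℝ} (hδ : 0 ≤ δ) {x x' : Site 2} {i : Fin 2}
    (hx' : x' ∈ s(x, x + Pi.single i 1)) :
    dist (meshPoint δ x') (medialPoint δ s(x, x + Pi.single i 1)) = δ / 2 := by
  have hn : ‖meshPoint δ (Pi.single i 1)‖ = δ := by rw [norm_meshPoint_single, abs_of_nonneg hδ]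
  -- `meshPoint` is additive (cf. the tree lemma `meshPoint_add` of `InterfaceSLETightness.lean`)
  have meshPoint_add : ∀ y : Site 2, meshPoint δ (x + y) = meshPoint δ x + meshPoint δ y :=
    fun y => by apply Complex.ext <;> simp [meshPoint] <;> ring
  rw [Complex.dist_eq, medialPoint_mk, meshPoint_add]
  rcases Sym2.mem_iff.1 hx' with rfl | rfl
  · rw [show meshPoint δ x' - (meshPoint δ x' + (meshPoint δ x' + meshPoint δ (Pi.single i 1))) / 2
        = -(meshPoint δ (Pi.single i 1) / 2) by ring, norm_neg, norm_div, hn]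
    simp
  · rw [meshPoint_add, show meshPoint δ x + meshPoint δ (Pi.single i 1) -
        (meshPoint δ x + (meshPoint δ x + meshPoint δ (Pi.single i 1))) / 2 =
        meshPoint δ (Pi.single i 1) / 2 by ring, norm_div, hn]
    simp

end TraceIdentity

open TraceIdentity

/-- **A `3δ/2`-deep site is not on the discrete boundary.** For any discrete Dobrushin datum `E`
with mesh `E.δ ≥ 0`: if the closed ball of radius `3δ/2` about the mesh point `δv` lies in the
domain `E.Ω`, then `v ∉ E.zdBoundary`. Both clauses of `zdBoundary` put `v` in `Ω_δ`; the
`ℤ²`-neighbours of `v`, and the corners of any face having `v` as a corner, are mesh vertices joined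
to `v` (in at most two steps) by lattice segments inside the ball, hence in the mesh component of
`v`, i.e. in `Ω_δ` (`mem_meshDomain_of_meshGraph_adj`): so every neighbour is `Ω_δ`-adjacent to `v`
(not a vertex-boundary site) and every face at `v` is inner (not an endpoint of a face-boundary
edge). (Smirnov 2010, §3, "interior vertices"; elementary.) -/
theorem not_mem_zdBoundary_of_closedBall_subset (E : DiscreteDobrushin) (hδ : 0 ≤ E.δ) {v : Site 2}
    (hv : closedBall (meshPoint E.δ v) (3 / 2 * E.δ) ⊆ E.Ω) : v ∉ E.zdBoundary := by
  -- `Near w`: `w` is within sup-distance one of `v`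
  let Near : Site 2 → Prop := fun w => ∀ j, |w j - v j| ≤ 1
  have near_self : Near v := fun j => by simp
  have hV : ∀ w, Near w → w ∈ meshVertices E.Ω E.δ := fun w hw =>
    hv (mem_closedBall.2 (dist_meshPoint_le_of_near hδ hw))
  have hA : ∀ w w', Near w → Near w' → (zdGraph 2).Adj w w' →
      (meshGraph E.Ω E.δ).Adj w w' := fun w w' hw hw' h =>
    meshGraph_adj_iff.2 ⟨h, (((convex_closedBall _ _).segment_subset
      (mem_closedBall.2 (dist_meshPoint_le_of_near hδ hw))
      (mem_closedBall.2 (dist_meshPoint_le_of_near hδ hw'))).trans hv).trans subset_closure⟩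
  have hD : ∀ w w', Near w → Near w' → w ∈ meshDomain E.Ω E.δ →
      (w = w' ∨ (zdGraph 2).Adj w w') → w' ∈ meshDomain E.Ω E.δ := by
    rintro w w' hw hw' hwD (rfl | h)
    · exact hwD
    · exact Literature.Probability.Percolation.mem_meshDomain_of_meshGraph_adj hwD (hV w' hw')
        (hA w w' hw hw' h)
  rintro (⟨hvD, y, hy, hnadj⟩ | ⟨y, hxy, -, f, hf, hvf, -⟩)
  · exact hnadj (discreteDomainGraph_adj_iff.2 ⟨hA v y near_self (near_of_adj hy) hy, hvD,
      hD v y near_self (near_of_adj hy) hvD (Or.inr hy)⟩)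
  · have hvD : v ∈ meshDomain E.Ω E.δ := (discreteDomainGraph_adj_iff.1 hxy).2.1
    have hcorner : ∀ a, IsCorner a f → a ∈ meshDomain E.Ω E.δ := fun a ha => by
      let m : Site 2 := ![a 0, v 1]
      have hm : IsCorner m f := fun j => by
        fin_cases j
        · exact ha 0
        · exact hvf 1
      have hva := near_of_isCorner hvf ha
      have hmD : m ∈ meshDomain E.Ω E.δ :=
        hD v m near_self (near_of_isCorner hvf hm) hvD
          (eq_or_adj_of_coord 0 (fun j hj => by fin_cases j <;> simp [m] at hj ⊢)
            (by simpa [m] using hva 0))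
      exact hD m a (near_of_isCorner hvf hm) hva hmD
        (eq_or_adj_of_coord 1 (fun j hj => by fin_cases j <;> simp [m] at hj ⊢)
          (by simpa [m] using hva 1))
    exact hf fun a b ha hb hab => discreteDomainGraph_adj_iff.2
      ⟨hA a b (near_of_isCorner hvf ha) (near_of_isCorner hvf hb) hab, hcorner a ha, hcorner b hb⟩

/-- **Deep lattice edges are not `A`–`B` edges** (registered helper of line
`finitary-green-pairing`): for any discrete Dobrushin datum `E` with mesh `E.δ ≥ 0` and any lattice
edge `s(x, x + eᵢ)`, if the closed `2δ`-ball about its midpoint lies in `E.Ω` then the edge is not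
one of the `A`–`B` boundary edges `E.zdABEdges`: such an edge has an endpoint on the discrete arc
`zdArcA ⊆ zdBoundary` (`mem_zdABEdges_iff`, `zdArcA_subset_zdBoundary`), while both endpoints, at
distance `δ/2` from the midpoint, are `3δ/2`-deep (`not_mem_zdBoundary_of_closedBall_subset`). No
admissibility is needed. -/
theorem medialPoint_far_not_mem_zdABEdges : ∀ (E : DiscreteDobrushin), 0 ≤ E.δ →
    ∀ (x : Site 2) (i : Fin 2),
      Metric.closedBall (medialPoint E.δ s(x, x + Pi.single i 1)) (2 * E.δ) ⊆ E.Ω →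
        s(x, x + Pi.single i 1) ∉ E.zdABEdges := by
  intro E hδ x i h hz
  obtain ⟨-, ⟨x', hx'z, hx'A⟩, -⟩ := E.mem_zdABEdges_iff.1 hz
  refine not_mem_zdBoundary_of_closedBall_subset E hδ ((closedBall_subset_closedBall' ?_).trans h)
    (E.zdArcA_subset_zdBoundary hx'A)
  linarith [dist_meshPoint_medialPoint hδ hx'z]

end Summit.CriticalPhenomena.CardyFormulaZ2.Cruxes.CoherentMorera.FinitaryGreenPairing
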